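import Summits.HodgeConjecture.HodgeConjecture.Theorems.R90S6EtaOneTwistedFLShellIdentity   -- ★ K8 FILE 1a (S.1) `sum_negOnePow_log_detZero_mul_epsOrbitalIntegral_eq_negOnePow_mul_sum`, (S.2) `orbitalIntegral_etaOneGraphPartner_heckeDiag_one∕two(_eq_one)` (brings ★ K7, ★ L4, ★ J1′, ★ TE5, ★ H2)
import HarnessLib

/-!
# R90 · S6 «Ch. 14.1–14.5 stable trace formula» — card K8 FILE 1b (row E1.4.4.3.1): THE `η̂₁` TWISTED FL AT THE FIRST SHELL — ANCHOR FORM AND THE FREE CONSISTENCY RUNG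
# (`Theorems/R90S6EtaOneTwistedFLShellAnchor.lean`)

Dealer R90-C14-plan (g2), card K8 rulings 02:47:13Z («GO FILE 1 = (S.1) + (S.2) + (S.3) HEAD = the ↔ anchor form incl. the FREE CONSISTENCY RUNG as a named corollary»);
split from FILE 1a `R90S6EtaOneTwistedFLShellIdentity` by the 400-line cap.  Seat R90-C14-p08 (g2).  Print [Rogawski1990] §4.10 (4.10.3) p. 58:
`Δ̃(δ)·Φ^κ̃_ε(δ, φ) = Φ^st(γ, η̂₁ φ)` for `φ ∈ ℋ̃`; `Δ̃(δ) = μ(det₀ δ)⁻¹ Δ_{G∕H}(γ)`.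

FRAME.  G̃ side = ★ L4 ∕ FILE 1a (S.1) letters (`GL₃(K)`, `Θ_σ`, shells `K̃ϖ^aK̃`, one cocycle `α_i` per class of `H¹(F,T)`, weights `κ̃(α) = (log v det₀ α).negOnePow`), the
FL instance's left side written as `Δ · ↑(Σ_i κ̃(α_i)·Φ_Θ(α_iδ, 1_{K̃ϖ^aK̃}; ν∕t_i))` with the transfer factor `Δ̃(δ)` ABSTRACTED to a letter `Δ : ℂ` (pin (J-b) of the census:
`(log v det₀ δ).negOnePow · (−q)^{log v((b−a)(b−c))}`, the (E1) sheet's Δ‴-letter; nothing here depends on its value).  H side = ★ H2-adic ∕ FILE 1a (S.2) letters at the inert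
unramified place `w ∣ v` of `E∕F`: the `𝒟_H(T∕F)`-classes as a finite family `γ_j ∈ U(J₀,2)(E_w)` (`j ∈ s_H`; 2 classes for type (1), 1 for type (2)), each with compact
centraliser of `ρ_j`-mass one; `η̂₁ = ` ★ `etaOneGraphPartnerAlgHom` on `T₁ = c_{(1,0,0)}`, `T₂ = c_{(1,1,0)}` of `ℋ(GL₃(K′), GL₃(𝒪′))` (★ TE5 binders).

* (S.3) HEAD **`etaOne_twistedFL_heckeDiag_one_iff`** — ANCHOR FORM AT `λ = (1,0,0)`: with the twisted shell COUNTS named `V i`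
  (`hV : #{q : q.out⁻¹(α_iδ)Θ_σ(q.out) ∈ K̃ϖ^{(1,0,0)}K̃} = V i` — the letters of the future E1.4.4.2.2 theorems; NOT ★ today at elliptic `γ`), the FL instance
  «`Δ · Σ_i κ̃(α_i)Φ_Θ(α_iδ, c_{(1,0,0)}) = Σ_j O_{γ_j}(η̂₁ T₁)`» is EQUIVALENT to the count identity
  «`Δ · (Σa + log v det δ).negOnePow · ν(K̃) · Σ_i ω((α_i)₁₁)·V_i = ν_H(K₀) · Σ_j Σ_{k<2} √Q·#{x ∈ X₂ self-dual : d(x, γ_j x) = 2k}`» — (S.1) + ★ J1′ on the left, (S.2) on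
  the right: the exact linear constraint on the first twisted shell that the 2-D layer must deliver (E1-ANCHOR pattern).
* (S.4) **`sum_negOnePow_log_detZero_mul_epsOrbitalIntegral_heckeDiag_one_eq_two`** — THE FREE CONSISTENCY RUNG: `η̂₁ T₁ = η̂₁ T₂` (★ TE-gen (N.2), FILE 1a
  `orbitalIntegral_etaOneGraphPartner_heckeDiag_two_eq_one`), so the FL instances at `c_{(1,0,0)}` and at `c_{(1,1,0)}` (hypotheses `h₁`, `h₂`) with `Δ ≠ 0` FORCE
  `Σ_i κ̃(α_i)Φ_Θ(α_iδ, c_{(1,0,0)}) = Σ_i κ̃(α_i)Φ_Θ(α_iδ, c_{(1,1,0)})` — a pure `GL₃`-lattice identity between the shells `(1,0,0)` and `(1,1,0)` (opposite determinant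
  parity: disjoint sets of surviving classes, ★ L2-sgn) that E1.4.4.2.2 must reproduce.
HONEST LABEL: bookkeeping; the FL instances are HYPOTHESES ∕ one side of an `↔`, proved by nobody here; the elliptic twisted counts are NOT ★ (E1.4.4.2.2 undealt);
count-neutral until E1.4.4.3.1 ∕ E1.4.4.5b consume it.  HC_CM is proved only modulo the 7 printed citations (2 remaining named inputs: hLiu418 = stmt-HodgeConjecture-24832,
h413 = stmt-HodgeConjecture-24833) until rung 0 closes; REL ≠ ★ ≠ BUILT.  Lane `--kind proof --supports stmt-HodgeConjecture-24833 --as helper`; THEOREMS ONLY.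

## Tree search (dedup)
`rg "etaOne_twistedFL|EtaOneTwistedFLShellAnchor|epsOrbitalIntegral_heckeDiag_one_eq_two"` over `lean/` — no hit (2026-09-05T03:00Z).

## References
* [Rogawski1990] J. D. Rogawski, *Automorphic Representations of Unitary Groups in Three Variables*, Ann. of Math. Stud. 123 (1990): §4.10 (4.10.1)–(4.10.3) pp. 57–58,
  Prop. 4.10.2 p. 58; §4.9 p. 55; §3.13 Prop. 3.13.1 p. 38.
* [Kottwitz1986BaseChangeUnits] R. E. Kottwitz, *Base change for unit elements of Hecke algebras*, Compositio Math. 60 (1986): §1 pp. 239–243.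
* [LabesseLanglands1979] J.-P. Labesse, R. P. Langlands, *L-indistinguishability for SL(2)*, Canad. J. Math. 31 (1979): §§2–3.
-/

set_option autoImplicit false
-- the mandated namespace repeats the single-problem summit's segment (`HodgeConjecture.HodgeConjecture`)
set_option linter.dupNamespace false

noncomputable section

open MeasureTheory Measure Topology Set
open scoped ENNReal Matrix MatrixGroups WithZero Pointwise ValuativeRel
open NumberField IsDedekindDomain
open Literature.MeasureTheory.Group Literature.NumberTheory.Automorphic Literature.NumberTheory.Automorphic.heckeAlgebra
  Literature.NumberTheory.Automorphic.HermitianLattice Literature.NumberTheory.Automorphic.HermitianLatticeTree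
  Literature.NumberTheory.Automorphic.UnitaryGroup Literature.NumberTheory.Automorphic.CartanUnique
  Literature.NumberTheory.Rogawski1990.Ch4Sec10
open Literature.NumberTheory.Rogawski1990.Ch3Sec10to13 (detZero)

namespace Summit.HodgeConjecture.HodgeConjecture.R90.S6

universe u

/-! ## §0 Generic: a weighted sum of twisted orbital integrals of `1_S` as `ν(K)` times a weighted sum of shell counts (★ J1′ termwise) -/

section Generic

variable {G : Type*} [Group G] [TopologicalSpace G] [IsTopologicalGroup G] [LocallyCompactSpace G]
  [SecondCountableTopology G] [T2Space G] [MeasurableSpace G] [BorelSpace G]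
  (ε : G →* G) (K : Subgroup G) {ι : Type*} (s : Finset ι) (d : ι → G)
  [∀ i, MeasurableSpace (G ⧸ epsCentralizer ε (d i))] [∀ i, BorelSpace (G ⧸ epsCentralizer ε (d i))]
  [hC : ∀ i, IsClosed ((epsCentralizer ε (d i) : Subgroup G) : Set G)]
  (t : ∀ i, Measure (epsCentralizer ε (d i))) [∀ i, (t i).IsMulLeftInvariant]
  [∀ i, IsFiniteMeasureOnCompacts (t i)] [∀ i, (t i).IsOpenPosMeasure] [∀ i, (t i).IsInvInvariant] [∀ i, SFinite (t i)]
  (ν : Measure G) [IsHaarMeasure ν] [ν.IsMulRightInvariant]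
  [∀ i, CompactSpace (epsCentralizer ε (d i))]
  (hε : Continuous ε) {S : Set G} (hS : IsOpen S) (hSK : ∀ k : G, k ∈ K → ∀ g : G, k * g * (ε k)⁻¹ ∈ S ↔ g ∈ S)

include hε hS hSK in
/-- **A weighted sum of twisted orbital integrals of `1_S` is `ν(K)` times the weighted sum of the shell counts**:
`Σ_{i ∈ s} κ_i·Φ_ε(d_i, 1_S; ν∕t_i) = ν(K) · Σ_{i ∈ s} κ_i·#{q ∈ G ⧸ K : q.out⁻¹ d_i ε(q.out) ∈ S}` (★ J1′ `epsOrbitalIntegral_indicator_quotientMeasure_eq_mul_ncard_shell`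
termwise; generic letters so that the `GL₃` instance is reached by unification only). [cite: Kottwitz1986BaseChangeUnits, §1 pp. 239–240] [cite: Rogawski1990, §4.10 (4.10.1) p. 57] -/
theorem sum_mul_epsOrbitalIntegral_indicator_eq_mul_sum_mul_ncard (hK : IsOpen (K : Set G)) (ht : ∀ i ∈ s, t i Set.univ = 1)
    (hfin : ∀ i ∈ s, {q : G ⧸ K | q.out⁻¹ * d i * ε q.out ∈ S}.Finite) (κ : ι → ℤˣ) :
    ∑ i ∈ s, (((κ i : ℤˣ) : ℤ) : ℝ) *
        epsOrbitalIntegral ε (d i) (S.indicator (1 : G → ℝ)) (quotientMeasure (epsCentralizer ε (d i)) (t i) (hC i) ν) =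
      (ν K).toReal * ∑ i ∈ s, (((κ i : ℤˣ) : ℤ) : ℝ) * ({q : G ⧸ K | q.out⁻¹ * d i * ε q.out ∈ S}.ncard : ℝ) := by
  rw [Finset.mul_sum]
  refine Finset.sum_congr rfl fun i hi => ?_
  rw [epsOrbitalIntegral_indicator_quotientMeasure_eq_mul_ncard_shell ε (d i) K (t i) ν hε hS hSK hK (ht i hi) (hfin i hi)]
  ring

end Generic

/-! ## (S.3) HEAD — the anchor form at the first shell `λ = (1,0,0)` -/

/-- **(S.3) HEAD — THE `η̂₁` FL AT `c_{(1,0,0)} = T₁`, ANCHOR FORM.**  G̃ side: ★ L4 binders at `N = 3` (`d_i = α_i·δ`, `(α_i)₁₁ ≠ 0`, shell `a = (1,0,0)`), the twisted shell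
counts NAMED `V i` (`hV`; the future E1.4.4.2.2 theorems — NOT ★ at elliptic `γ` today); H side: the `𝒟_H(T∕F)`-classes `γ_j ∈ U(J₀,2)(E_w)` (`j ∈ s_H`, compact centralisers of
`ρ_j`-mass one, finitely many self-dual vertices displaced by `0`, `2`), ★ H2-adic binders; `Δ : ℂ` the transfer-factor letter.  THEN the FL instance
`Δ · ↑(Σ_i κ̃(α_i)·Φ_Θ(α_iδ, 1_{K̃ϖ^aK̃}; ν∕t_i)) = Σ_j O_{γ_j}^{ν_H∕ρ_j}(g ↦ (η̂₁ T₁ [K₀])(gK₀))` holds IFF the COUNT identity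
`Δ · ↑((Σa + log v det δ).negOnePow · ν(K̃) · Σ_i ω((α_i)₁₁)·V_i) = ν_H(K₀) · Σ_j Σ_{k<2} √Q · #{x ∈ X₂(E_w) self-dual : d(x, γ_j x) = 2k}` holds
(FILE 1a (S.1) + ★ J1′ `epsOrbitalIntegral_indicator_quotientMeasure_eq_mul_ncard_shell` on the left, FILE 1a (S.2) on the right).
[cite: Rogawski1990, §4.10 (4.10.1)–(4.10.3) pp. 57–58] [cite: Kottwitz1986BaseChangeUnits, §1 pp. 239–243] [cite: LabesseLanglands1979, §§2–3] -/
theorem etaOne_twistedFL_heckeDiag_one_iff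
    -- the G̃ side (★ L4 letters)
    {K : Type} [Field K] [Valued K ℤᵐ⁰] [ValuativeRel K] [(Valued.v : Valuation K ℤᵐ⁰).Compatible] {σ : K →+* K}
    {ϖ : K} (hϖ : IsUniformizingElement ϖ) (hvϖ : Valued.v ϖ = WithZero.exp (-1 : ℤ))
    [LocallyCompactSpace (GL (Fin 3) K)] [SecondCountableTopology (GL (Fin 3) K)] [MeasurableSpace (GL (Fin 3) K)] [BorelSpace (GL (Fin 3) K)]
    (hvσ : ∀ a, Valued.v (σ a) = Valued.v a) {ι : Type*} (s : Finset ι) (α : ι → GL (Fin 3) K) (δ : GL (Fin 3) K) (a : Fin 3 → ℤ)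
    [∀ i, MeasurableSpace (GL (Fin 3) K ⧸
      epsCentralizer (MonoidHom.mk' (UnitaryGroup.qsInvolution σ) (UnitaryGroup.qsInvolution_mul σ)) (α i * δ))]
    [∀ i, BorelSpace (GL (Fin 3) K ⧸
      epsCentralizer (MonoidHom.mk' (UnitaryGroup.qsInvolution σ) (UnitaryGroup.qsInvolution_mul σ)) (α i * δ))]
    [hC : ∀ i, IsClosed ((epsCentralizer (MonoidHom.mk' (UnitaryGroup.qsInvolution σ) (UnitaryGroup.qsInvolution_mul σ)) (α i * δ) :
      Subgroup (GL (Fin 3) K)) : Set (GL (Fin 3) K))]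
    (t : ∀ i, Measure (epsCentralizer (MonoidHom.mk' (UnitaryGroup.qsInvolution σ) (UnitaryGroup.qsInvolution_mul σ)) (α i * δ)))
    [∀ i, (t i).IsMulLeftInvariant] [∀ i, IsFiniteMeasureOnCompacts (t i)] [∀ i, (t i).IsOpenPosMeasure] [∀ i, (t i).IsInvInvariant]
    [∀ i, SFinite (t i)] (ν : Measure (GL (Fin 3) K)) [IsHaarMeasure ν] [ν.IsMulRightInvariant]
    [∀ i, CompactSpace (epsCentralizer (MonoidHom.mk' (UnitaryGroup.qsInvolution σ) (UnitaryGroup.qsInvolution_mul σ)) (α i * δ))]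
    (hΘ : Continuous ⇑(MonoidHom.mk' (UnitaryGroup.qsInvolution σ) (UnitaryGroup.qsInvolution_mul σ) : GL (Fin 3) K →* GL (Fin 3) K))
    (hK : IsOpen (glInt 3 K : Set (GL (Fin 3) K))) (ht : ∀ i ∈ s, t i Set.univ = 1)
    (hfin : ∀ i ∈ s, {q : GL (Fin 3) K ⧸ glInt 3 K |
      q.out⁻¹ * (α i * δ) * UnitaryGroup.qsInvolution σ q.out ∈
        (glInt 3 K : Set (GL (Fin 3) K)) * {zpowDiagGL hϖ.ne_zero a} * (glInt 3 K : Set (GL (Fin 3) K))}.Finite)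
    (h11 : ∀ i ∈ s, ((α i : GL (Fin 3) K) : Matrix (Fin 3) (Fin 3) K) 1 1 ≠ 0)
    (V : ι → ℕ) (hV : ∀ i ∈ s, {q : GL (Fin 3) K ⧸ glInt 3 K |
      q.out⁻¹ * (α i * δ) * UnitaryGroup.qsInvolution σ q.out ∈
        (glInt 3 K : Set (GL (Fin 3) K)) * {zpowDiagGL hϖ.ne_zero a} * (glInt 3 K : Set (GL (Fin 3) K))}.ncard = V i)
    -- the H side (★ H2-adic letters) and the `GL₃` Hecke source of `η̂₁` (★ TE5 letters)
    {F E : Type} [Field F] [NumberField F] [Field E] [NumberField E] [Algebra F E] [Algebra.IsQuadraticExtension F E]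
    (c : E ≃ₐ[F] E) (hc1 : c ≠ 1) (v : HeightOneSpectrum (𝓞 F)) (w : PlacesOver E v) (hw : c • w.1 = w.1)
    (hv : Algebra.IsUnramifiedIn (𝓞 E) v.asIdeal)
    {K' : Type u} [Field K'] [ValuativeRel K'] [IsDiscreteValuationRing 𝒪[K']] [Finite 𝓀[K']] {ϖ' : K'}
    [IsHeckeTriple (⊤ : Submonoid (GL (Fin 3) K')) (glInt 3 K') (glInt 3 K')]
    (hϖ' : IsUniformizingElement ϖ') {u : ℂˣ} (hu : (u : ℂ) ^ 2 = ((Nat.card 𝓀[K'] : ℕ) : ℂ))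
    {wt : Multiplicative (Fin 3 → ℤ) →* ℂ}
    (hwt : ∀ e : Fin 3 → ℤ, wt (Multiplicative.ofAdd e) = ((u ^ ((((3 : ℕ) : ℤ) - 1) * (∑ i, e i) - 2 * satakeTwistExp e) : ℂˣ) : ℂ))
    (hqQ : ((Nat.card 𝓀[K'] : ℕ) : ℂ) = (Nat.card (Valued.ResidueField (w.1.adicCompletion E)) : ℂ))
    (hA : ∀ M : Submodule 𝒪[w.1.adicCompletion E] (Fin 2 → w.1.adicCompletion E),
      IsSelfDualLattice (galAdicCompletionMap (L := E) c hw) ((StdForm.antidiagonal 2).over (w.1.adicCompletion E)) M →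
        ∃ g : unitaryGroupOfForm (galAdicCompletionMap (L := E) c hw) ((StdForm.antidiagonal 2).over (w.1.adicCompletion E)),
          latt (((g : GL (Fin 2) (w.1.adicCompletion E))) : Matrix (Fin 2) (Fin 2) (w.1.adicCompletion E)) = M)
    [LocallyCompactSpace (unitaryGroupOfForm (galAdicCompletionMap (L := E) c hw) ((StdForm.antidiagonal 2).over (w.1.adicCompletion E)))]
    [SecondCountableTopology (unitaryGroupOfForm (galAdicCompletionMap (L := E) c hw) ((StdForm.antidiagonal 2).over (w.1.adicCompletion E)))]
    [MeasurableSpace (unitaryGroupOfForm (galAdicCompletionMap (L := E) c hw) ((StdForm.antidiagonal 2).over (w.1.adicCompletion E)))]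
    [BorelSpace (unitaryGroupOfForm (galAdicCompletionMap (L := E) c hw) ((StdForm.antidiagonal 2).over (w.1.adicCompletion E)))]
    {κ : Type*} (sH : Finset κ) (γ : κ → unitaryGroupOfForm (galAdicCompletionMap (L := E) c hw) ((StdForm.antidiagonal 2).over (w.1.adicCompletion E)))
    [∀ j, MeasurableSpace (unitaryGroupOfForm (galAdicCompletionMap (L := E) c hw) ((StdForm.antidiagonal 2).over (w.1.adicCompletion E)) ⧸
      Subgroup.centralizer ({γ j} : Set (unitaryGroupOfForm (galAdicCompletionMap (L := E) c hw) ((StdForm.antidiagonal 2).over (w.1.adicCompletion E)))))]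
    [∀ j, BorelSpace (unitaryGroupOfForm (galAdicCompletionMap (L := E) c hw) ((StdForm.antidiagonal 2).over (w.1.adicCompletion E)) ⧸
      Subgroup.centralizer ({γ j} : Set (unitaryGroupOfForm (galAdicCompletionMap (L := E) c hw) ((StdForm.antidiagonal 2).over (w.1.adicCompletion E)))))]
    [hCH : ∀ j, IsClosed ((Subgroup.centralizer ({γ j} : Set (unitaryGroupOfForm (galAdicCompletionMap (L := E) c hw)
      ((StdForm.antidiagonal 2).over (w.1.adicCompletion E))))) : Set (unitaryGroupOfForm (galAdicCompletionMap (L := E) c hw)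
        ((StdForm.antidiagonal 2).over (w.1.adicCompletion E))))]
    (ρ : ∀ j, Measure (Subgroup.centralizer ({γ j} : Set (unitaryGroupOfForm (galAdicCompletionMap (L := E) c hw)
      ((StdForm.antidiagonal 2).over (w.1.adicCompletion E))))))
    [∀ j, (ρ j).IsMulLeftInvariant] [∀ j, IsFiniteMeasureOnCompacts (ρ j)] [∀ j, (ρ j).IsOpenPosMeasure] [∀ j, (ρ j).IsInvInvariant] [∀ j, SFinite (ρ j)]
    (νH : Measure (unitaryGroupOfForm (galAdicCompletionMap (L := E) c hw) ((StdForm.antidiagonal 2).over (w.1.adicCompletion E))))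
    [IsHaarMeasure νH] [νH.IsMulRightInvariant]
    [∀ j, CompactSpace (Subgroup.centralizer ({γ j} : Set (unitaryGroupOfForm (galAdicCompletionMap (L := E) c hw)
      ((StdForm.antidiagonal 2).over (w.1.adicCompletion E)))))]
    (hρ : ∀ j ∈ sH, ρ j Set.univ = 1)
    (hfinH : ∀ j ∈ sH, ∀ k ≤ 1, {x : {M : Submodule 𝒪[w.1.adicCompletion E] (Fin 2 → w.1.adicCompletion E) //
        IsSpecialLattice (galAdicCompletionMap (L := E) c hw) (localConjUniformizer c hc1 v w hw hv)
          ((StdForm.antidiagonal 2).over (w.1.adicCompletion E)) M} |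
        IsSelfDualLattice (galAdicCompletionMap (L := E) c hw) ((StdForm.antidiagonal 2).over (w.1.adicCompletion E)) x.1 ∧
          (latticeTree (galAdicCompletionMap (L := E) c hw) (localConjUniformizer c hc1 v w hw hv)
              ((StdForm.antidiagonal 2).over (w.1.adicCompletion E))).dist x
            (latticeTreeIso (galAdicCompletionMap (L := E) c hw) (localConjUniformizer c hc1 v w hw hv)
              ((StdForm.antidiagonal 2).over (w.1.adicCompletion E)) (γ j) x) = 2 * k}.Finite)
    (Δ : ℂ) :
    haveI := isHeckeTriple_unitaryInt_adicCompletion c v w hw ((StdForm.antidiagonal 2).over (w.1.adicCompletion E))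
    (Δ * ((∑ i ∈ s, ((((WithZero.log (Valued.v (detZero K (α i)))).negOnePow : ℤˣ) : ℤ) : ℝ) *
          epsOrbitalIntegral (MonoidHom.mk' (UnitaryGroup.qsInvolution σ) (UnitaryGroup.qsInvolution_mul σ)) (α i * δ)
            (((glInt 3 K : Set (GL (Fin 3) K)) * {zpowDiagGL hϖ.ne_zero a} * (glInt 3 K : Set (GL (Fin 3) K))).indicator (1 : GL (Fin 3) K → ℝ))
            (quotientMeasure (epsCentralizer (MonoidHom.mk' (UnitaryGroup.qsInvolution σ) (UnitaryGroup.qsInvolution_mul σ)) (α i * δ))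
              (t i) (hC i) ν) : ℝ) : ℂ) =
        ∑ j ∈ sH, orbitalIntegral (γ j)
          (fun x : unitaryGroupOfForm (galAdicCompletionMap (L := E) c hw) ((StdForm.antidiagonal 2).over (w.1.adicCompletion E)) =>
            (toVector (unitaryInt (galAdicCompletionMap (L := E) c hw) ((StdForm.antidiagonal 2).over (w.1.adicCompletion E)))
              (etaOneGraphPartnerAlgHom c hc1 v w hw hv hϖ' hu hwt
                (doubleCosetOperator (glInt 3 K') (heckeDiag 3 (Units.mk0 ϖ' hϖ'.ne_zero) 1)))).coeff
            (x : unitaryGroupOfForm (galAdicCompletionMap (L := E) c hw) ((StdForm.antidiagonal 2).over (w.1.adicCompletion E)) ⧸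
              unitaryInt (galAdicCompletionMap (L := E) c hw) ((StdForm.antidiagonal 2).over (w.1.adicCompletion E))))
          (quotientMeasure (Subgroup.centralizer ({γ j} : Set (unitaryGroupOfForm (galAdicCompletionMap (L := E) c hw)
            ((StdForm.antidiagonal 2).over (w.1.adicCompletion E))))) (ρ j) (hCH j) νH)) ↔
      (Δ * ((((((∑ j, a j + WithZero.log (Valued.v ((δ : GL (Fin 3) K) : Matrix (Fin 3) (Fin 3) K).det)).negOnePow : ℤˣ) : ℤ) : ℝ) *
            ((ν (glInt 3 K : Set (GL (Fin 3) K))).toReal *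
              ∑ i ∈ s, ((((WithZero.log (Valued.v (((α i : GL (Fin 3) K) : Matrix (Fin 3) (Fin 3) K) 1 1))).negOnePow : ℤˣ) : ℤ) : ℝ) * (V i : ℝ)) : ℝ) : ℂ) =
        ((νH (unitaryInt (galAdicCompletionMap (L := E) c hw) ((StdForm.antidiagonal 2).over (w.1.adicCompletion E)))).toReal : ℂ) *
          ∑ j ∈ sH, ∑ k ∈ Finset.range 2, ((Nat.sqrt (Nat.card (Valued.ResidueField (w.1.adicCompletion E))) : ℕ) : ℂ) *
            ({x : {M : Submodule 𝒪[w.1.adicCompletion E] (Fin 2 → w.1.adicCompletion E) //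
                IsSpecialLattice (galAdicCompletionMap (L := E) c hw) (localConjUniformizer c hc1 v w hw hv)
                  ((StdForm.antidiagonal 2).over (w.1.adicCompletion E)) M} |
                IsSelfDualLattice (galAdicCompletionMap (L := E) c hw) ((StdForm.antidiagonal 2).over (w.1.adicCompletion E)) x.1 ∧
                  (latticeTree (galAdicCompletionMap (L := E) c hw) (localConjUniformizer c hc1 v w hw hv)
                      ((StdForm.antidiagonal 2).over (w.1.adicCompletion E))).dist x
                    (latticeTreeIso (galAdicCompletionMap (L := E) c hw) (localConjUniformizer c hc1 v w hw hv)
                      ((StdForm.antidiagonal 2).over (w.1.adicCompletion E)) (γ j) x) = 2 * k}.ncard : ℂ)) := by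
  haveI := isHeckeTriple_unitaryInt_adicCompletion c v w hw ((StdForm.antidiagonal 2).over (w.1.adicCompletion E))
  -- the named counts in ★ J1′'s spelling of the shell set (`ε q.out`, `ε = MonoidHom.mk' Θ_σ _`; definitionally `hV`)
  have hV' : ∀ i ∈ s, {q : GL (Fin 3) K ⧸ glInt 3 K |
      q.out⁻¹ * (α i * δ) * (MonoidHom.mk' (UnitaryGroup.qsInvolution σ) (UnitaryGroup.qsInvolution_mul σ)) q.out ∈
        (glInt 3 K : Set (GL (Fin 3) K)) * {zpowDiagGL hϖ.ne_zero a} * (glInt 3 K : Set (GL (Fin 3) K))}.ncard = V i := hV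
  -- G̃ side: (S.1), then ★ J1′ termwise and the count letters
  have hG : ∑ i ∈ s, ((((WithZero.log (Valued.v (detZero K (α i)))).negOnePow : ℤˣ) : ℤ) : ℝ) *
        epsOrbitalIntegral (MonoidHom.mk' (UnitaryGroup.qsInvolution σ) (UnitaryGroup.qsInvolution_mul σ)) (α i * δ)
          (((glInt 3 K : Set (GL (Fin 3) K)) * {zpowDiagGL hϖ.ne_zero a} * (glInt 3 K : Set (GL (Fin 3) K))).indicator (1 : GL (Fin 3) K → ℝ))
          (quotientMeasure (epsCentralizer (MonoidHom.mk' (UnitaryGroup.qsInvolution σ) (UnitaryGroup.qsInvolution_mul σ)) (α i * δ))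
            (t i) (hC i) ν) =
      ((((∑ j, a j + WithZero.log (Valued.v ((δ : GL (Fin 3) K) : Matrix (Fin 3) (Fin 3) K).det)).negOnePow : ℤˣ) : ℤ) : ℝ) *
        ((ν (glInt 3 K : Set (GL (Fin 3) K))).toReal *
          ∑ i ∈ s, ((((WithZero.log (Valued.v (((α i : GL (Fin 3) K) : Matrix (Fin 3) (Fin 3) K) 1 1))).negOnePow : ℤˣ) : ℤ) : ℝ) * (V i : ℝ)) := by
    rw [sum_negOnePow_log_detZero_mul_epsOrbitalIntegral_eq_negOnePow_mul_sum hϖ hvϖ hvσ s α δ a t ν hΘ hK ht hfin h11]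
    congr 1
    refine (sum_mul_epsOrbitalIntegral_indicator_eq_mul_sum_mul_ncard
      (MonoidHom.mk' (UnitaryGroup.qsInvolution σ) (UnitaryGroup.qsInvolution_mul σ)) (glInt 3 K) s (fun i => α i * δ) t ν hΘ
      (isOpen_doubleCoset_of_isOpen hK _) (twistedConj_mem_doubleCoset_iff hvσ _) hK ht hfin _).trans ?_
    congr 1
    refine Finset.sum_congr rfl fun i hi => ?_
    rw [hV' i hi]
  -- H side: (S.2) class by class
  have hH : ∑ j ∈ sH, orbitalIntegral (γ j)
        (fun x : unitaryGroupOfForm (galAdicCompletionMap (L := E) c hw) ((StdForm.antidiagonal 2).over (w.1.adicCompletion E)) =>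
          (toVector (unitaryInt (galAdicCompletionMap (L := E) c hw) ((StdForm.antidiagonal 2).over (w.1.adicCompletion E)))
            (etaOneGraphPartnerAlgHom c hc1 v w hw hv hϖ' hu hwt
              (doubleCosetOperator (glInt 3 K') (heckeDiag 3 (Units.mk0 ϖ' hϖ'.ne_zero) 1)))).coeff
          (x : unitaryGroupOfForm (galAdicCompletionMap (L := E) c hw) ((StdForm.antidiagonal 2).over (w.1.adicCompletion E)) ⧸
            unitaryInt (galAdicCompletionMap (L := E) c hw) ((StdForm.antidiagonal 2).over (w.1.adicCompletion E))))
        (quotientMeasure (Subgroup.centralizer ({γ j} : Set (unitaryGroupOfForm (galAdicCompletionMap (L := E) c hw)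
          ((StdForm.antidiagonal 2).over (w.1.adicCompletion E))))) (ρ j) (hCH j) νH) =
      ((νH (unitaryInt (galAdicCompletionMap (L := E) c hw) ((StdForm.antidiagonal 2).over (w.1.adicCompletion E)))).toReal : ℂ) *
        ∑ j ∈ sH, ∑ k ∈ Finset.range 2, ((Nat.sqrt (Nat.card (Valued.ResidueField (w.1.adicCompletion E))) : ℕ) : ℂ) *
          ({x : {M : Submodule 𝒪[w.1.adicCompletion E] (Fin 2 → w.1.adicCompletion E) //
              IsSpecialLattice (galAdicCompletionMap (L := E) c hw) (localConjUniformizer c hc1 v w hw hv)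
                ((StdForm.antidiagonal 2).over (w.1.adicCompletion E)) M} |
              IsSelfDualLattice (galAdicCompletionMap (L := E) c hw) ((StdForm.antidiagonal 2).over (w.1.adicCompletion E)) x.1 ∧
                (latticeTree (galAdicCompletionMap (L := E) c hw) (localConjUniformizer c hc1 v w hw hv)
                    ((StdForm.antidiagonal 2).over (w.1.adicCompletion E))).dist x
                  (latticeTreeIso (galAdicCompletionMap (L := E) c hw) (localConjUniformizer c hc1 v w hw hv)
                    ((StdForm.antidiagonal 2).over (w.1.adicCompletion E)) (γ j) x) = 2 * k}.ncard : ℂ) := by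
    rw [Finset.mul_sum]
    exact Finset.sum_congr rfl fun j hj =>
      orbitalIntegral_etaOneGraphPartner_heckeDiag_one c hc1 v w hw hv hϖ' hu hwt hqQ hA (γ j) (ρ j) νH (hρ j hj) (hfinH j hj)
  exact Iff.of_eq (congrArg₂ (fun (x : ℝ) (y : ℂ) => Δ * (x : ℂ) = y) hG hH)

/-! ## (S.4) The free consistency rung: the FL instances at `c_{(1,0,0)}` and `c_{(1,1,0)}` force equal G̃-side sums -/

/-- **(S.4) THE FREE CONSISTENCY RUNG.**  Since `η̂₁ T₁ = η̂₁ T₂` (★ TE-gen (N.2); FILE 1a `orbitalIntegral_etaOneGraphPartner_heckeDiag_two_eq_one`), the H sides of the FL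
instances at `c_{(1,0,0)} = T₁` (shell `a₁`) and at `c_{(1,1,0)} = T₂` (shell `a₂`) are the SAME number; so the two instances (hypotheses `h₁`, `h₂`, transfer-factor letter
`Δ ≠ 0`) force `Σ_i κ̃(α_i)·Φ_Θ(α_iδ, 1_{K̃ϖ^{a₁}K̃}; ν∕t_i) = Σ_i κ̃(α_i)·Φ_Θ(α_iδ, 1_{K̃ϖ^{a₂}K̃}; ν∕t_i)` — at `a₁ = (1,0,0)`, `a₂ = (1,1,0)` the surviving classes have
OPPOSITE determinant parity (★ L2-sgn), so this is a genuine identity between disjoint families of twisted lattice counts that the 2-D layer (E1.4.4.2.2) must reproduce.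
No finiteness ∕ mass-one ∕ Haar-normalisation hypothesis enters. [cite: Rogawski1990, §4.10 Prop. 4.10.1 (b), Prop. 4.10.2 p. 58] [cite: Kottwitz1986BaseChangeUnits, §1 pp. 239–243] -/
theorem sum_negOnePow_log_detZero_mul_epsOrbitalIntegral_heckeDiag_one_eq_two
    -- the G̃ side (★ L4 letters), two shells `a₁`, `a₂`
    {K : Type} [Field K] [Valued K ℤᵐ⁰] [ValuativeRel K] [(Valued.v : Valuation K ℤᵐ⁰).Compatible] {σ : K →+* K}
    {ϖ : K} (hϖ : IsUniformizingElement ϖ)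
    [LocallyCompactSpace (GL (Fin 3) K)] [SecondCountableTopology (GL (Fin 3) K)] [MeasurableSpace (GL (Fin 3) K)] [BorelSpace (GL (Fin 3) K)]
    {ι : Type*} (s : Finset ι) (α : ι → GL (Fin 3) K) (δ : GL (Fin 3) K) (a₁ a₂ : Fin 3 → ℤ)
    [∀ i, MeasurableSpace (GL (Fin 3) K ⧸
      epsCentralizer (MonoidHom.mk' (UnitaryGroup.qsInvolution σ) (UnitaryGroup.qsInvolution_mul σ)) (α i * δ))]
    [∀ i, BorelSpace (GL (Fin 3) K ⧸
      epsCentralizer (MonoidHom.mk' (UnitaryGroup.qsInvolution σ) (UnitaryGroup.qsInvolution_mul σ)) (α i * δ))]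
    [hC : ∀ i, IsClosed ((epsCentralizer (MonoidHom.mk' (UnitaryGroup.qsInvolution σ) (UnitaryGroup.qsInvolution_mul σ)) (α i * δ) :
      Subgroup (GL (Fin 3) K)) : Set (GL (Fin 3) K))]
    (t : ∀ i, Measure (epsCentralizer (MonoidHom.mk' (UnitaryGroup.qsInvolution σ) (UnitaryGroup.qsInvolution_mul σ)) (α i * δ)))
    [∀ i, (t i).IsMulLeftInvariant] [∀ i, IsFiniteMeasureOnCompacts (t i)] [∀ i, (t i).IsOpenPosMeasure] [∀ i, (t i).IsInvInvariant]
    (ν : Measure (GL (Fin 3) K)) [IsFiniteMeasureOnCompacts ν] [ν.IsMulRightInvariant]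
    -- the H side (★ H2-adic letters) and the `GL₃` Hecke source of `η̂₁` (★ TE5 letters)
    {F E : Type} [Field F] [NumberField F] [Field E] [NumberField E] [Algebra F E] [Algebra.IsQuadraticExtension F E]
    (c : E ≃ₐ[F] E) (hc1 : c ≠ 1) (v : HeightOneSpectrum (𝓞 F)) (w : PlacesOver E v) (hw : c • w.1 = w.1)
    (hv : Algebra.IsUnramifiedIn (𝓞 E) v.asIdeal)
    {K' : Type u} [Field K'] [ValuativeRel K'] [IsDiscreteValuationRing 𝒪[K']] [Finite 𝓀[K']] {ϖ' : K'}
    [IsHeckeTriple (⊤ : Submonoid (GL (Fin 3) K')) (glInt 3 K') (glInt 3 K')]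
    (hϖ' : IsUniformizingElement ϖ') {u : ℂˣ} (hu : (u : ℂ) ^ 2 = ((Nat.card 𝓀[K'] : ℕ) : ℂ))
    {wt : Multiplicative (Fin 3 → ℤ) →* ℂ}
    (hwt : ∀ e : Fin 3 → ℤ, wt (Multiplicative.ofAdd e) = ((u ^ ((((3 : ℕ) : ℤ) - 1) * (∑ i, e i) - 2 * satakeTwistExp e) : ℂˣ) : ℂ))
    [LocallyCompactSpace (unitaryGroupOfForm (galAdicCompletionMap (L := E) c hw) ((StdForm.antidiagonal 2).over (w.1.adicCompletion E)))]
    [SecondCountableTopology (unitaryGroupOfForm (galAdicCompletionMap (L := E) c hw) ((StdForm.antidiagonal 2).over (w.1.adicCompletion E)))]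
    [MeasurableSpace (unitaryGroupOfForm (galAdicCompletionMap (L := E) c hw) ((StdForm.antidiagonal 2).over (w.1.adicCompletion E)))]
    [BorelSpace (unitaryGroupOfForm (galAdicCompletionMap (L := E) c hw) ((StdForm.antidiagonal 2).over (w.1.adicCompletion E)))]
    {κ : Type*} (sH : Finset κ) (γ : κ → unitaryGroupOfForm (galAdicCompletionMap (L := E) c hw) ((StdForm.antidiagonal 2).over (w.1.adicCompletion E)))
    [∀ j, MeasurableSpace (unitaryGroupOfForm (galAdicCompletionMap (L := E) c hw) ((StdForm.antidiagonal 2).over (w.1.adicCompletion E)) ⧸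
      Subgroup.centralizer ({γ j} : Set (unitaryGroupOfForm (galAdicCompletionMap (L := E) c hw) ((StdForm.antidiagonal 2).over (w.1.adicCompletion E)))))]
    [∀ j, BorelSpace (unitaryGroupOfForm (galAdicCompletionMap (L := E) c hw) ((StdForm.antidiagonal 2).over (w.1.adicCompletion E)) ⧸
      Subgroup.centralizer ({γ j} : Set (unitaryGroupOfForm (galAdicCompletionMap (L := E) c hw) ((StdForm.antidiagonal 2).over (w.1.adicCompletion E)))))]
    [hCH : ∀ j, IsClosed ((Subgroup.centralizer ({γ j} : Set (unitaryGroupOfForm (galAdicCompletionMap (L := E) c hw)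
      ((StdForm.antidiagonal 2).over (w.1.adicCompletion E))))) : Set (unitaryGroupOfForm (galAdicCompletionMap (L := E) c hw)
        ((StdForm.antidiagonal 2).over (w.1.adicCompletion E))))]
    (ρ : ∀ j, Measure (Subgroup.centralizer ({γ j} : Set (unitaryGroupOfForm (galAdicCompletionMap (L := E) c hw)
      ((StdForm.antidiagonal 2).over (w.1.adicCompletion E))))))
    [∀ j, (ρ j).IsMulLeftInvariant] [∀ j, IsFiniteMeasureOnCompacts (ρ j)] [∀ j, (ρ j).IsOpenPosMeasure] [∀ j, (ρ j).IsInvInvariant]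
    (νH : Measure (unitaryGroupOfForm (galAdicCompletionMap (L := E) c hw) ((StdForm.antidiagonal 2).over (w.1.adicCompletion E))))
    [IsFiniteMeasureOnCompacts νH] [νH.IsMulRightInvariant]
    {Δ : ℂ} (hΔ : Δ ≠ 0)
    (h₁ : haveI := isHeckeTriple_unitaryInt_adicCompletion c v w hw ((StdForm.antidiagonal 2).over (w.1.adicCompletion E))
      Δ * ((∑ i ∈ s, ((((WithZero.log (Valued.v (detZero K (α i)))).negOnePow : ℤˣ) : ℤ) : ℝ) *
          epsOrbitalIntegral (MonoidHom.mk' (UnitaryGroup.qsInvolution σ) (UnitaryGroup.qsInvolution_mul σ)) (α i * δ)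
            (((glInt 3 K : Set (GL (Fin 3) K)) * {zpowDiagGL hϖ.ne_zero a₁} * (glInt 3 K : Set (GL (Fin 3) K))).indicator (1 : GL (Fin 3) K → ℝ))
            (quotientMeasure (epsCentralizer (MonoidHom.mk' (UnitaryGroup.qsInvolution σ) (UnitaryGroup.qsInvolution_mul σ)) (α i * δ))
              (t i) (hC i) ν) : ℝ) : ℂ) =
        ∑ j ∈ sH, orbitalIntegral (γ j)
          (fun x : unitaryGroupOfForm (galAdicCompletionMap (L := E) c hw) ((StdForm.antidiagonal 2).over (w.1.adicCompletion E)) =>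
            (toVector (unitaryInt (galAdicCompletionMap (L := E) c hw) ((StdForm.antidiagonal 2).over (w.1.adicCompletion E)))
              (etaOneGraphPartnerAlgHom c hc1 v w hw hv hϖ' hu hwt
                (doubleCosetOperator (glInt 3 K') (heckeDiag 3 (Units.mk0 ϖ' hϖ'.ne_zero) 1)))).coeff
            (x : unitaryGroupOfForm (galAdicCompletionMap (L := E) c hw) ((StdForm.antidiagonal 2).over (w.1.adicCompletion E)) ⧸
              unitaryInt (galAdicCompletionMap (L := E) c hw) ((StdForm.antidiagonal 2).over (w.1.adicCompletion E))))
          (quotientMeasure (Subgroup.centralizer ({γ j} : Set (unitaryGroupOfForm (galAdicCompletionMap (L := E) c hw)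
            ((StdForm.antidiagonal 2).over (w.1.adicCompletion E))))) (ρ j) (hCH j) νH))
    (h₂ : haveI := isHeckeTriple_unitaryInt_adicCompletion c v w hw ((StdForm.antidiagonal 2).over (w.1.adicCompletion E))
      Δ * ((∑ i ∈ s, ((((WithZero.log (Valued.v (detZero K (α i)))).negOnePow : ℤˣ) : ℤ) : ℝ) *
          epsOrbitalIntegral (MonoidHom.mk' (UnitaryGroup.qsInvolution σ) (UnitaryGroup.qsInvolution_mul σ)) (α i * δ)
            (((glInt 3 K : Set (GL (Fin 3) K)) * {zpowDiagGL hϖ.ne_zero a₂} * (glInt 3 K : Set (GL (Fin 3) K))).indicator (1 : GL (Fin 3) K → ℝ))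
            (quotientMeasure (epsCentralizer (MonoidHom.mk' (UnitaryGroup.qsInvolution σ) (UnitaryGroup.qsInvolution_mul σ)) (α i * δ))
              (t i) (hC i) ν) : ℝ) : ℂ) =
        ∑ j ∈ sH, orbitalIntegral (γ j)
          (fun x : unitaryGroupOfForm (galAdicCompletionMap (L := E) c hw) ((StdForm.antidiagonal 2).over (w.1.adicCompletion E)) =>
            (toVector (unitaryInt (galAdicCompletionMap (L := E) c hw) ((StdForm.antidiagonal 2).over (w.1.adicCompletion E)))
              (etaOneGraphPartnerAlgHom c hc1 v w hw hv hϖ' hu hwt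
                (doubleCosetOperator (glInt 3 K') (heckeDiag 3 (Units.mk0 ϖ' hϖ'.ne_zero) 2)))).coeff
            (x : unitaryGroupOfForm (galAdicCompletionMap (L := E) c hw) ((StdForm.antidiagonal 2).over (w.1.adicCompletion E)) ⧸
              unitaryInt (galAdicCompletionMap (L := E) c hw) ((StdForm.antidiagonal 2).over (w.1.adicCompletion E))))
          (quotientMeasure (Subgroup.centralizer ({γ j} : Set (unitaryGroupOfForm (galAdicCompletionMap (L := E) c hw)
            ((StdForm.antidiagonal 2).over (w.1.adicCompletion E))))) (ρ j) (hCH j) νH)) :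
    ∑ i ∈ s, ((((WithZero.log (Valued.v (detZero K (α i)))).negOnePow : ℤˣ) : ℤ) : ℝ) *
        epsOrbitalIntegral (MonoidHom.mk' (UnitaryGroup.qsInvolution σ) (UnitaryGroup.qsInvolution_mul σ)) (α i * δ)
          (((glInt 3 K : Set (GL (Fin 3) K)) * {zpowDiagGL hϖ.ne_zero a₁} * (glInt 3 K : Set (GL (Fin 3) K))).indicator (1 : GL (Fin 3) K → ℝ))
          (quotientMeasure (epsCentralizer (MonoidHom.mk' (UnitaryGroup.qsInvolution σ) (UnitaryGroup.qsInvolution_mul σ)) (α i * δ))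
            (t i) (hC i) ν) =
      ∑ i ∈ s, ((((WithZero.log (Valued.v (detZero K (α i)))).negOnePow : ℤˣ) : ℤ) : ℝ) *
        epsOrbitalIntegral (MonoidHom.mk' (UnitaryGroup.qsInvolution σ) (UnitaryGroup.qsInvolution_mul σ)) (α i * δ)
          (((glInt 3 K : Set (GL (Fin 3) K)) * {zpowDiagGL hϖ.ne_zero a₂} * (glInt 3 K : Set (GL (Fin 3) K))).indicator (1 : GL (Fin 3) K → ℝ))
          (quotientMeasure (epsCentralizer (MonoidHom.mk' (UnitaryGroup.qsInvolution σ) (UnitaryGroup.qsInvolution_mul σ)) (α i * δ))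
            (t i) (hC i) ν) := by
  haveI := isHeckeTriple_unitaryInt_adicCompletion c v w hw ((StdForm.antidiagonal 2).over (w.1.adicCompletion E))
  -- the two H sides agree class by class (`η̂₁ T₂ = η̂₁ T₁`)
  have e : ∀ j ∈ sH, orbitalIntegral (γ j)
        (fun x : unitaryGroupOfForm (galAdicCompletionMap (L := E) c hw) ((StdForm.antidiagonal 2).over (w.1.adicCompletion E)) =>
          (toVector (unitaryInt (galAdicCompletionMap (L := E) c hw) ((StdForm.antidiagonal 2).over (w.1.adicCompletion E)))
            (etaOneGraphPartnerAlgHom c hc1 v w hw hv hϖ' hu hwt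
              (doubleCosetOperator (glInt 3 K') (heckeDiag 3 (Units.mk0 ϖ' hϖ'.ne_zero) 2)))).coeff
          (x : unitaryGroupOfForm (galAdicCompletionMap (L := E) c hw) ((StdForm.antidiagonal 2).over (w.1.adicCompletion E)) ⧸
            unitaryInt (galAdicCompletionMap (L := E) c hw) ((StdForm.antidiagonal 2).over (w.1.adicCompletion E))))
        (quotientMeasure (Subgroup.centralizer ({γ j} : Set (unitaryGroupOfForm (galAdicCompletionMap (L := E) c hw)
          ((StdForm.antidiagonal 2).over (w.1.adicCompletion E))))) (ρ j) (hCH j) νH) =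
      orbitalIntegral (γ j)
        (fun x : unitaryGroupOfForm (galAdicCompletionMap (L := E) c hw) ((StdForm.antidiagonal 2).over (w.1.adicCompletion E)) =>
          (toVector (unitaryInt (galAdicCompletionMap (L := E) c hw) ((StdForm.antidiagonal 2).over (w.1.adicCompletion E)))
            (etaOneGraphPartnerAlgHom c hc1 v w hw hv hϖ' hu hwt
              (doubleCosetOperator (glInt 3 K') (heckeDiag 3 (Units.mk0 ϖ' hϖ'.ne_zero) 1)))).coeff
          (x : unitaryGroupOfForm (galAdicCompletionMap (L := E) c hw) ((StdForm.antidiagonal 2).over (w.1.adicCompletion E)) ⧸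
            unitaryInt (galAdicCompletionMap (L := E) c hw) ((StdForm.antidiagonal 2).over (w.1.adicCompletion E))))
        (quotientMeasure (Subgroup.centralizer ({γ j} : Set (unitaryGroupOfForm (galAdicCompletionMap (L := E) c hw)
          ((StdForm.antidiagonal 2).over (w.1.adicCompletion E))))) (ρ j) (hCH j) νH) :=
    fun j _ => orbitalIntegral_etaOneGraphPartner_heckeDiag_two_eq_one c hc1 v w hw hv hϖ' hu hwt (γ j) _
  rw [Finset.sum_congr rfl e] at h₂
  exact Complex.ofReal_injective (mul_left_cancel₀ hΔ (h₁.trans h₂.symm))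

end Summit.HodgeConjecture.HodgeConjecture.R90.S6

end
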